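import Summits.AnomalousDissipation.AnomalousDissipation.Theses.TaylorCertificates
import Summits.AnomalousDissipation.AnomalousDissipation.Theorems.TaylorCertificatePair.Negative.Modes
import Literature.Analysis.FunctionSpaces.TorusFluidGlueProofs
import Literature.Analysis.FunctionSpaces.TorusLerayHelmholtzProofs
import Literature.Analysis.FunctionSpaces.TorusCalculusProofs
import Literature.Analysis.FunctionSpaces.TorusTestFunction
import Literature.Analysis.FunctionSpaces.TorusChainRule
import Literature.Analysis.FluidPDE.OnsagerBDSVGluing

/-!
# The Lamb identity: stub `stub_lambForm` of the line `Sketch` (helical path) for the crux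
# `TaylorCertificates.SmoothEulerCoerciveForce` (stmt-AnomalousDissipation-14097)

For a smooth vector field `v` on the flat three-torus `T³ = (ℝ/ℤ)³` this file proves the pointwise
**Lamb (Bernoulli) identity**

  `(v·∇)v = (curl v) × v + ∇(|v|²/2)`,

with the tree's accepted torus calculus (`Torus.convect`, `Torus.gradient`, `Torus.partialDeriv` of
`Literature/Analysis/FunctionSpaces/TorusCalculus.lean`), the accepted curl `BDSV.curl`
(`Literature/Analysis/FluidPDE/OnsagerBDSVGluing.lean`) and Mathlib's `crossProduct` on `Fin 3 → ℝ`.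
It is pure coordinate calculus: `((v·∇)v)ᵢ = ∑ⱼ vⱼ ∂ⱼvᵢ` (`Torus.fderiv_apply_eq_sum_partialDeriv`),
`(∇(|v|²/2))ᵢ = ∑ⱼ vⱼ ∂ᵢvⱼ` (`Torus.gradient_eq_sum_partialDeriv`, `Torus.partialDeriv_half_norm_sq`),
and the three components of `(curl v) × v` (`cross_apply`) close the polynomial identity
`∑ⱼ vⱼ ∂ⱼvᵢ = ((curl v) × v)ᵢ + ∑ⱼ vⱼ ∂ᵢvⱼ`.

Reference: A. J. Majda, A. L. Bertozzi, *Vorticity and incompressible flow*, CUP 2002, §1.1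
(the identity `(v·∇)v = ω × v + ∇(|v|²/2)` behind the Bernoulli form of Euler); folklore.

NOT here: any statement about Euler solutions, pressures or forces (the neighbouring stubs of the
line), nor the vorticity transport equation.
-/

-- `Summit.<Summit>.<Problem>` is the tree's mandated summit-side namespace (CONVENTIONS §2); for this
-- single-conjunct summit the two coincide, so the duplicate is deliberate.
set_option linter.dupNamespace false

noncomputable section

open MeasureTheory
open scoped InnerProductSpace

namespace Summit.AnomalousDissipation.AnomalousDissipation.Theorems.SmoothEulerCoerciveForce.Helical

open Literature.Analysis.FunctionSpaces
open Summit.AnomalousDissipation.AnomalousDissipation.Theses.TaylorCertificates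
open Summit.AnomalousDissipation.AnomalousDissipation.Theorems.TaylorCertificatePair.Negative

/-- Components of the convective term: `((v·∇)v)ᵢ(x) = ∑ⱼ vⱼ(x) ∂ⱼvᵢ(x)` for a `C¹` field on `T³`.
[folklore] -/
private theorem lambForm_convect_apply {v : UnitAddTorus (Fin 3) → EuclideanSpace ℝ (Fin 3)}
    (hv : Torus.IsContDiff 1 v) (x : UnitAddTorus (Fin 3)) (i : Fin 3) :
    Torus.convect v v x i = ∑ j, v x j * Torus.partialDeriv j v x i := by
  rw [Torus.convect, Torus.fderiv_apply_eq_sum_partialDeriv hv x (v x)]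
  simp only [WithLp.ofLp_sum, WithLp.ofLp_smul, Finset.sum_apply, Pi.smul_apply, smul_eq_mul]

/-- Components of the Bernoulli gradient: `(∇(|v|²/2))ᵢ(x) = ∑ⱼ vⱼ(x) ∂ᵢvⱼ(x)` for a `C¹` field
on `T³`. [folklore] -/
private theorem lambForm_gradient_apply {v : UnitAddTorus (Fin 3) → EuclideanSpace ℝ (Fin 3)}
    (hv : Torus.IsContDiff 1 v) (x : UnitAddTorus (Fin 3)) (i : Fin 3) :
    Torus.gradient (fun y => ‖v y‖ ^ 2 / 2) x i = ∑ j, v x j * Torus.partialDeriv i v x j := by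
  have hθ : Torus.IsContDiff 1 (fun y => ‖v y‖ ^ 2 / 2) := (hv.norm_sq ℝ).div_const 2
  have h1 : Torus.gradient (fun y => ‖v y‖ ^ 2 / 2) x i =
      Torus.partialDeriv i (fun y => ‖v y‖ ^ 2 / 2) x := by
    rw [Torus.gradient_eq_sum_partialDeriv hθ]
    simp [Finset.sum_apply, Pi.single_apply]
  rw [h1, Torus.partialDeriv_half_norm_sq hv]
  refine Finset.sum_congr rfl fun j _ => ?_
  rw [Torus.partialDeriv_apply_coord hv i x j]

/-- **Stub 4 (Lamb identity; pure calculus).** For a smooth vector field `v` on `T³`,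
`(v·∇)v = (curl v) × v + ∇(|v|²/2)` pointwise, with the accepted `Torus.convect`, `BDSV.curl`,
`Torus.gradient` and Mathlib's `crossProduct` (Majda–Bertozzi §1.1). [folklore] -/
theorem stub_lambForm
    (v : UnitAddTorus (Fin 3) → EuclideanSpace ℝ (Fin 3)) (hvs : Torus.IsSmooth v) :
    ∀ x, Torus.convect v v x =
      WithLp.toLp 2 (crossProduct (WithLp.ofLp (Literature.Analysis.FluidPDE.BDSV.curl v x))
        (WithLp.ofLp (v x))) + Torus.gradient (fun y => ‖v y‖ ^ 2 / 2) x := by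
  intro x
  have hv : Torus.IsContDiff 1 v := hvs.isContDiff (by simp)
  ext i
  rw [PiLp.add_apply, lambForm_convect_apply hv x i, lambForm_gradient_apply hv x i]
  fin_cases i <;>
    simp [Fin.sum_univ_three, Literature.Analysis.FluidPDE.BDSV.curl, cross_apply] <;> ring

end Summit.AnomalousDissipation.AnomalousDissipation.Theorems.SmoothEulerCoerciveForce.Helical

end
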